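import Summits.CriticalPhenomena.PercolationContinuityZ3.Theorems.PercNearOneGluingNoHeavyLowerTailSahiTangentVertexFourFKG

/-!
# `NoHeavyLowerTail` (crux stmt-CriticalPhenomena-4575), Sahi programme: the order-3 MIXED vertex (two top-only slots, one plain) for arbitrary up-sets under
# every FKG weight — completing "Conjecture T_n holds at EVERY vertex for n ≤ 5"

Support file (Sahi cell, seat `prim-sahi-p1`, generation 50; `--supports stmt-CriticalPhenomena-4575`).  Pure proofs, NO definitions, no `sorry`,
standard axioms.  With `sahiE_three_coin_topOnly_ge` (all three slots top-only, `…VertexFourFKG`), the order-4 shapes (`…VertexFourFKG`) and the order-5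
shapes (`…VertexFiveFKG`, `…VertexFiveFKGMixed`), every vertex shape with at least two top-only slots is covered at orders 3, 4, 5 (one top-only slot is
an equality, `SahiTangent.sahiE_coin_top`); slots are relabelled by `sahiE_comp_perm`.
THE RESULT (`sahiE_three_coin_vertex2_ge`): for up-sets `U_0, U_1, U_2`, FKG `ν`, `s ∈ [0,1]`:
`s·E_3^{ν}(1_{U_0},1_{U_1},1_{U_2}) ≤ E_3^{B_s⊗ν}(ε·1_{U_0}, ε·1_{U_1}, 1_{U_2})`; indeed the difference is `s(1−s)[X_0X_{12} + X_1X_{02} − X_0X_1X_2] ≥ 0` (Harris).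
Nothing conjectural is asserted. [this work]
-/

namespace Summit.CriticalPhenomena.PercolationContinuityZ3.Theorems.SahiTangent

open Finset Function Literature.Combinatorics.Sahi2008
open Literature.Probability.LatticeModels (mass mass_nonneg)
open scoped BigOperators

noncomputable section

variable {α : Type*} [DistribLattice α] [Fintype α] [DecidableEq α]

/-- **Order 3, two top-only slots** (`0,1` top-only, `2` plain), arbitrary up-sets, any FKG weight. [this work] -/
theorem sahiE_three_coin_vertex2_ge {ν : α → ℝ} (hν : IsFKGMeasure ν) {s : ℝ} (hs0 : 0 ≤ s) (hs1 : s ≤ 1) (U : Fin 3 → Finset α)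
    (hU : ∀ l, IsUpperSet (U l : Set α)) :
    s * sahiE ν 3 (fun l => setInd (U l)) ≤
      sahiE (fun z : Bool × α => if z.1 then s * ν z.2 else (1 - s) * ν z.2) 3
        ![fun z : Bool × α => if z.1 then setInd (U 0) z.2 else 0, fun z : Bool × α => if z.1 then setInd (U 1) z.2 else 0,
          fun z : Bool × α => setInd (U 2) z.2] := by
  have e1 : (fun l => setInd (U l)) = ![setInd (U 0), setInd (U 1), setInd (U 2)] := by
    funext l; fin_cases l <;> rfl
  rw [e1, sahiE_three, sahiE_three]
  simp only [topOnly_mul, topOnly_mul_plain, ex_coin_topOnly, ex_coin_plain, setInd_mul, ex_setInd]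
  have n0 := mass_nonneg (μ := ν) (fun x => hν.nonneg x) (U 0)
  have n1 := mass_nonneg (μ := ν) (fun x => hν.nonneg x) (U 1)
  have n2 := mass_nonneg (μ := ν) (fun x => hν.nonneg x) (U 2)
  have h12 := harris_mass hν (hU 1) (hU 2)
  have h02 := harris_mass hν (hU 0) (hU 2)
  have h01 := harris_mass hν (hU 0) (hU 1)
  have h1s : 0 ≤ 1 - s := sub_nonneg.2 hs1
  have hP : 0 ≤ mass ν (U 0) * mass ν (U 1) * mass ν (U 2) := mul_nonneg (mul_nonneg n0 n1) n2
  nlinarith [mul_nonneg (mul_nonneg hs0 h1s) (mul_nonneg n0 (sub_nonneg.2 h12)), mul_nonneg (mul_nonneg hs0 h1s) (mul_nonneg n1 (sub_nonneg.2 h02)),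
    mul_nonneg (mul_nonneg hs0 h1s) (mul_nonneg n2 (sub_nonneg.2 h01)), mul_nonneg (mul_nonneg hs0 h1s) hP,
    mul_nonneg (mul_nonneg hs0 h1s) (mul_nonneg h1s hP), mul_nonneg hs0 (mul_nonneg hs0 hP)]

end

end Summit.CriticalPhenomena.PercolationContinuityZ3.Theorems.SahiTangent
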